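import Mathlib

/-!
# C4 on the 2-level WNSH-LF window — the apex/ray pincer (hsemireg-c4-1 g25)

Typed spec + kernel-checked arithmetic/algebra behind memo `C4-WINDOW-PINCER-c4-1-g25.md`
(crux `BlochSeedDiscOne`, item stmt-HodgeConjecture-18881; evidence only — nothing here is a rung
toward HC / HC_AV / the crux; no `sorry`, no new axioms, Mathlib only, no instances / notation).

Dictionary (g0 memo `C4-STABILITY-c4-1-g0.md` §1): a letter on one factor `S = E × E` is a triple
`[α, x, y]` = `α·(u+v) + x·X + y·Y`, with `n[α,x,y] = α² − x² − y²`; its numerical character in the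
basis `(1, A, pt)` of the Lefschetz part is `(1, α, (α² − x² − y²)·?)` — for the three HUB/RAY letters of
the 2-level alphabet `14I=[14,0,0]`, `15I=[15,0,0]`, `R̄ := [13,·,·]` (Lefschetz part of a ray letter)
the `(1, A, pt)`-coordinates are `(1,14,196)`, `(1,15,225)`, `(1,13,168)` (`pt`-coefficient `= n/…`
normalised as in monad-4 g23: `χ`-vector third entry `α²−x²−y² = 168` for `[13,±1,0]`).

§1  the three letter vectors form a unimodular basis of the Lefschetz lattice `ℤ³ = ⟨1, A, pt⟩` and
    `pt = R̄ − 2·14I + 15I`  (APEX/HUB LAW coefficients `(+1, −2, +1)`);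
§2  forced hub values `ν(14Iᵃ 15Iᵇ) = κ(−2)ᵃ + 4[a=4]` and the canonical-lift count tests
    `D = κ(−1)ᵃ + 4[a=4]`, `D∨ = κ 2ᵇ(−1)ᵃ + 4` at `κ = 1792` (class `C(14, 448+224i)`);
§3  the `c₄`-complement identity behind the NO-LETTER-SUMMAND lemma;
§4  the algebra kernel of the non-simplicity theorem: an injective linear map into an algebra whose
    image multiplies to zero misses `1`, so `dim End ≥ dim(source) + 1`.
-/

namespace HSemireg.C4WindowPincer

/-! ## §1 Letter vectors of the 2-level alphabet in the basis `(1, A, pt)` -/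

/-- `(1, A, pt)`-coordinates of the Lefschetz part of a letter `[α, x, y]`: `(1, α, α² − x² − y²)`…
scaled as in the monad-4 class vectors (third coordinate = `χ`-type entry `α²−x²−y²` times the
factor normalisation; only the three values below are used). -/
def vR : Fin 3 → ℤ := ![1, 13, 168]
def v14 : Fin 3 → ℤ := ![1, 14, 196]
def v15 : Fin 3 → ℤ := ![1, 15, 225]
/-- the point class of one factor in the same coordinates -/
def vpt : Fin 3 → ℤ := ![0, 0, 1]

/-- APEX/HUB LAW coefficients: `pt_f = v(R̄) − 2·v(14I) + v(15I)`. -/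
theorem pt_eq_comb : vpt = vR - 2 • v14 + v15 := by
  ext i; fin_cases i <;> simp [vpt, vR, v14, v15]

/-- The letter matrix (rows `R̄, 14I, 15I`) is unimodular: the three letters are a `ℤ`-basis of the
Lefschetz lattice `⟨1, A, pt⟩`, so every class has UNIQUE coordinates in `{R̄,14I,15I,X,Y}^{⊗4}`. -/
def letterMatrix : Matrix (Fin 3) (Fin 3) ℤ := !![1, 13, 168; 1, 14, 196; 1, 15, 225]

theorem letterMatrix_det : letterMatrix.det = 1 := by
  simp [letterMatrix, Matrix.det_fin_three]

/-- `4·e^{14A}` per factor is the letter vector of `14I` itself (coefficient extraction is trivial). -/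
theorem e14_is_v14 : v14 = ![1, 14, 14 ^ 2] := by
  ext i; fin_cases i <;> simp [v14]

/-! ## §2 Forced hub values and canonical-lift count tests (`κ = |μ|²/140`) -/

/-- forced virtual multiplicity on the hub cell with `a` slots `14I` and `4 − a` slots `15I`:
coefficient of `⊗ v` in `4·v14^{⊗4} + w + κ·⊗(vR − 2 v14 + v15)`. -/
def hubNu (κ : ℤ) (a : ℕ) : ℤ := κ * (-2) ^ a + if a = 4 then 4 else 0

/-- canonical-lift count test `D(Z) = Σ_{Z' ≥ Z} K(Z'−Z) ν(Z')` at a hub cell (`K(15I−14I) = 1`):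
`κ · Σ_{T ⊆ [a]} (−2)^{a−|T|} + 4[a=4] = κ(−1)^a + 4[a=4]`. -/
def hubD (κ : ℤ) (a : ℕ) : ℤ := κ * (-1) ^ a + if a = 4 then 4 else 0

/-- dual count test `D∨(Z) = Σ_{Z' ≤ Z} K(Z−Z') ν(Z')` at a hub cell: per `15I`-slot the letters below
contribute `1·1 + 1·(−2) + 3·1 = 2` (`K(15I−R) = det[2,∓1,0] = 3`, four rays summing the `R̄`-coefficient
`1`), per `14I`-slot `(−2) + 1 = −1`; plus `4` from `(14I)⁴`. -/
def hubDv (κ : ℤ) (a : ℕ) : ℤ := κ * 2 ^ (4 - a) * (-1) ^ a + 4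

/-- the per-slot sums behind `hubD` / `hubDv` -/
theorem slot_sums : ((1 : ℤ) + (-2) = -1) ∧ ((1 : ℤ) * 1 + 1 * (-2) + 3 * 1 = 2) ∧
    ((2 : ℤ) ^ 2 - 1 ^ 2 - 0 ^ 2 = 3) ∧ (Int.gcd 1 1 = 1) := by decide

/-- binomial form of the `D`-sum: `Σ_k C(a,k) (−2)^{a−k} = (−1)^a` for `a ≤ 4`. -/
theorem D_binomial : ∀ a ∈ Finset.range 5,
    (∑ k ∈ Finset.range (a + 1), (a.choose k : ℤ) * (-2) ^ (a - k)) = (-1) ^ a := by decide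

theorem hub_values_1792 :
    (List.range 5).map (hubNu 1792) = [1792, -3584, 7168, -14336, 28676] ∧
    (List.range 5).map (hubD 1792) = [1792, -1792, 1792, -1792, 1796] ∧
    (List.range 5).map (hubDv 1792) = [28676, -14332, 7172, -3580, 1796] := by decide

/-- `κ = |μ|²/140` for `μ = 448 + 224 i`, and the forced apex value equals `κ > 0`. -/
theorem kappa_window : (448 ^ 2 + 224 ^ 2 : ℤ) = 140 * 1792 ∧ hubNu 1792 0 = 1792 ∧ 0 < hubNu 1792 0 := by
  decide

/-- total forced `ν`-mass: hub cells `Σ_a C(4,a) ν = κ(1−2)⁴ + 4 = κ + 4`, and every ray-slot pattern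
sums to `κ·Π(hub coefficients)`; in particular `Σ_{all-ray cells} ν = κ` and the signed total is
`rank 𝓔 = 4` (`(1 + (−2) + 1)^4 κ + 4 = 4`). -/
theorem mass_identities (κ : ℤ) :
    (1 * (κ * 1) + 4 * (κ * (-2)) + 6 * (κ * 4) + 4 * (κ * (-8)) + 1 * (κ * 16)) + 4 = κ + 4 ∧
    ((1 : ℤ) + (-2) + 1) ^ 4 * κ + 4 = 4 ∧
    ((Nat.choose 4 0, Nat.choose 4 1, Nat.choose 4 2, Nat.choose 4 3, Nat.choose 4 4) = (1, 4, 6, 4, 1)) := by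
  refine ⟨by ring, by ring, by decide⟩

/-- letter slopes (`s[α,x,y]·4 factors`): rays `52`, bundle `56 = 4g`, apex `60`; the pincer
`s_min = 52 < s(𝓔) = 56 < s_max = 60`, i.e. `μ_max(𝓔) ≥ 60·u > μ(𝓔) = 56·u > 52·u ≥ μ_min(𝓔)`
with `u = Θ_f·Θ⁷ = 10080`, `Θ⁸ = 40320`. -/
theorem slope_window : (4 * 13 : ℤ) = 52 ∧ (4 * 14 : ℤ) = 56 ∧ (4 * 15 : ℤ) = 60 ∧
    (52 : ℤ) < 56 ∧ (56 : ℤ) < 60 ∧ (Nat.factorial 8 = 40320) ∧ (40320 / 4 = 10080) := by decide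

/-- `h⁰(L_⊤ ⊗ L_R⁻¹ ⊗ P) = Π_f det[2, ∓1, 0] = 3⁴ = 81` for EVERY `P ∈ Pic⁰` (positive definite
difference, index 0), whence `h⁰(End 𝓔) ≥ 1 + 81` labelling-free; canonical lift: `≥ 1 + D∨(⊤)`. -/
theorem endo_bounds : (3 : ℕ) ^ 4 = 81 ∧ 1 + 81 = 82 ∧ 1 + hubDv 1792 0 = 28677 ∧
    1 + hubDv 1792 2 = 7173 := by decide

/-! ## §3 The `c₄`-complement identity (NO-LETTER-SUMMAND lemma)

If `𝓔 ≅ L ⊕ 𝓔'` with `rank 𝓔' = 3` then `c₄(𝓔') = 0`; with the WNSH total Chern class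
`c(𝓔) = (1 + gH)⁴ − 6w` one gets `c₄(𝓔') = [c(𝓔)·(1+ℓ)⁻¹]₄ = (gH − ℓ)⁴ − 6w`, `ℓ = c₁(L)`.
The polynomial identity used: -/
theorem c4_complement {R : Type*} [CommRing R] (x l w : R) :
    (x ^ 4 - 6 * w) - (4 * x ^ 3) * l + (6 * x ^ 2) * l ^ 2 - (4 * x) * l ^ 3 + l ^ 4
      = (x - l) ^ 4 - 6 * w := by
  ring

/-- geometric-series inverse to degree 4: `(1+ℓ)·(1 − ℓ + ℓ² − ℓ³ + ℓ⁴) = 1 + ℓ⁵`. -/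
theorem inv_one_add_trunc {R : Type*} [CommRing R] (l : R) :
    (1 + l) * (1 - l + l ^ 2 - l ^ 3 + l ^ 4) = 1 + l ^ 5 := by ring

/-- For a ray slot the letter difference `δ_f = −A_f + xX_f + yY_f` is isotropic: `n[−1,x,y] = 0`
when `x² + y² = 1`; for a `15I` slot `n[1,0,0] = 1`.  (Used: `δ⁴` has Weil component `±24·m_S`
(one monomial) on an all-ray cell and `0` otherwise, while `6w` has all sixteen `m_S`-coordinates
`6·Re(μ(−i)^{|S|})/8 ≠ 0` for `μ = 448+224i`.) -/
theorem ray_isotropic : ∀ x y : ℤ, x ^ 2 + y ^ 2 = 1 → (-1) ^ 2 - x ^ 2 - y ^ 2 = 0 := by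
  intro x y h; linarith

theorem weil_coords_nonzero : (6 * 448 : ℤ) ≠ 0 ∧ (6 * 224 : ℤ) ≠ 0 ∧ (24 : ℤ) ≠ 6 * 448 / 8 ∧
    (24 : ℤ) ≠ 6 * 224 / 8 ∧ (16 : ℕ) > 1 := by decide

/-! ## §4 Algebra kernel of the non-simplicity theorem

Model: `A = End(𝓔)` (a nontrivial `K`-algebra), `U = Hom(𝓔, L)` (resp. `H⁰(L_⊤ ⊗ L_R⁻¹)`),
`Φ : U →ₗ A`, `Φ ψ = j₀ ∘ s₀ ∘ ψ` — injective because `j₀, s₀` are monomorphisms, and with image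
multiplying to zero because `ψ ∘ j₀ = 0` (strict pair: `Hom(L_⊤, L_R) = 0`; same cell: NO-LETTER-SUMMAND).
-/

section algebra
variable {K A U : Type*} [Field K] [Ring A] [Algebra K A] [AddCommGroup U] [Module K U]

/-- If a subspace `N` of an algebra multiplies to zero, it does not contain `1`. -/
theorem one_not_mem_of_mul_eq_zero [Nontrivial A] (N : Submodule K A)
    (h : ∀ x ∈ N, ∀ y ∈ N, x * y = 0) : (1 : A) ∉ N := by
  intro h1
  have := h 1 h1 1 h1
  simp at this

/-- Hence an injective linear map `Φ : U → A` whose image multiplies to zero forces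
`finrank A ≥ finrank U + 1` (ambient finite-dimensional). -/
theorem finrank_succ_le_of_sqzero_embedding [Nontrivial A] [FiniteDimensional K A]
    (Φ : U →ₗ[K] A) (hinj : Function.Injective Φ)
    (h : ∀ x ∈ LinearMap.range Φ, ∀ y ∈ LinearMap.range Φ, x * y = 0) :
    Module.finrank K U + 1 ≤ Module.finrank K A := by
  have h1 : (1 : A) ∉ LinearMap.range Φ := one_not_mem_of_mul_eq_zero _ h
  have hlt : LinearMap.range Φ < ⊤ := lt_top_iff_ne_top.mpr (fun htop => h1 (htop ▸ Submodule.mem_top))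
  have hr : Module.finrank K (LinearMap.range Φ) = Module.finrank K U :=
    LinearMap.finrank_range_of_inj hinj
  have := Submodule.finrank_lt_finrank_of_lt hlt
  rw [hr, finrank_top] at this
  omega

/-- Composition with a monomorphism on the left is injective on Hom-spaces
(`ψ ↦ j ∘ ψ`; used with `j = j₀ ∘ s₀ : L_R → 𝓔`). -/
theorem comp_left_injective {V W : Type*} [AddCommGroup V] [Module K V] [AddCommGroup W] [Module K W]
    (j : V →ₗ[K] W) (hj : Function.Injective j) :
    Function.Injective (fun ψ : U →ₗ[K] V => j.comp ψ) := by
  intro ψ ψ' hψ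
  ext u
  exact hj (by simpa using LinearMap.congr_fun hψ u)

/-- An endomorphism factoring through a line cannot be the identity of a space of dimension `≥ 2`
(generic-fibre form of "`id ∉ span{j ∘ ψ}`", independent of the summand lemma). -/
theorem comp_ne_id_of_rank_one {V L : Type*} [AddCommGroup V] [Module K V] [AddCommGroup L]
    [Module K L] [FiniteDimensional K L] (hL : Module.finrank K L = 1) (hV : 2 ≤ Module.finrank K V)
    [FiniteDimensional K V] (j : L →ₗ[K] V) (ψ : V →ₗ[K] L) : j.comp ψ ≠ LinearMap.id := by
  intro h
  have hinj : Function.Injective ψ := by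
    intro a b hab
    have ha := LinearMap.congr_fun h a
    have hb := LinearMap.congr_fun h b
    simp only [LinearMap.coe_comp, Function.comp_apply, LinearMap.id_coe, id_eq] at ha hb
    rw [← ha, ← hb, hab]
  have := LinearMap.finrank_le_finrank_of_injective hinj
  omega

end algebra

/-! ## §5 Predicate spec (letter level) -/

/-- A letter of the 2-level alphabet, as `(α, x, y)`. -/
abbrev Letter := ℤ × ℤ × ℤ

def alpha (l : Letter) : ℤ := l.1
def nrm (l : Letter) : ℤ := l.1 ^ 2 - l.2.1 ^ 2 - l.2.2 ^ 2

/-- `l ≤ l'` in the letter poset iff `l' − l` is `0` or has `α > 0` and `n ≥ 0`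
(then `h⁰ > 0` under the canonical lift). -/
def letterLE (l l' : Letter) : Bool :=
  decide (l = l') || (decide (0 < l'.1 - l.1) && decide (0 ≤ nrm (l'.1 - l.1, l'.2.1 - l.2.1, l'.2.2 - l.2.2)))

def L14 : Letter := (14, 0, 0)
def L15 : Letter := (15, 0, 0)
def rays : List Letter := [(13, 1, 0), (13, -1, 0), (13, 0, 1), (13, 0, -1)]

/-- the poset facts used by THEOREM 2L: every ray is below `14I` (isotropic difference, `K = gcd = 1`),
`14I < 15I` (`K = 1`), ray below `15I` with POSITIVE DEFINITE difference (`n = 3`, so `h⁰ = 3` for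
every `Pic⁰`-translate), and distinct rays are incomparable. -/
theorem poset_facts :
    (rays.all fun r => letterLE r L14) = true ∧ letterLE L14 L15 = true ∧
    (rays.all fun r => letterLE r L15 && decide (nrm (L15.1 - r.1, L15.2.1 - r.2.1, L15.2.2 - r.2.2) = 3))
      = true ∧
    (rays.all fun r => rays.all fun r' => decide (r = r') || !(letterLE r r')) = true ∧
    (rays.all fun r => decide (nrm (L14.1 - r.1, L14.2.1 - r.2.1, L14.2.2 - r.2.2) = 0)) = true := by
  decide

/-- C4 VERDICT PREDICATE (letter level) for a WNSH-LF design on the 2-level alphabet with `κ > 0`: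
the apex is the unique maximal cell with forced `ν = κ > 0` and some minimal (ray) cell has `ν > 0`
(their `ν` sum to `κ`), so THEOREM A / A∨ fire at slopes `60 > 56 > 52`: `𝓔` is μ-UNSTABLE with
letter-visible destabilising sub (apex) and quotient (ray), and NOT SIMPLE (`h⁰(End) ≥ 82`). -/
def PincerFires (κ sTop sE sBot : ℤ) : Prop := 0 < κ ∧ sBot < sE ∧ sE < sTop

theorem pincer_window : PincerFires 1792 60 56 52 := by unfold PincerFires; decide

end HSemireg.C4WindowPincer
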